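import Mathlib
import HarnessLib
import Summits.ResolutionOfSingularities.ResolutionOfSingularities.Theorems.WildQuotientsWildQuotientResolutionS1aA1Root

/-!
# S1a — INSTANCE I-3 (D₄), ring level, MOVE 4 of MT-D₄ (v1.1) = THE KILL: on the model ring of the `[Y]₂` chart the (1,1,2)-centre `(s₃, W′, s)` is admissible
# relative to `β = s·t·s₃`, and its residual ideal contains `Y′·A`, `X₁·Z·B` and `C·Y′` — one unit on EACH of the three charts

[OURS · L1 W4.5c · lead-1 g13; plan-1 RULING R-F15e, X-CERT v1.1 §2 / v1.2-D4ROWS §1 move 4 «centre (e₃:1, x₂′:1, e₂:2); charts [e₃], [x₂′], N(e₂) ALL KILLED»,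
FRAME-STATUS rev16 §3] — NOT statements of the manuscript; counted 0; AI-level work, weaker than expert review. Crux stmt-ResolutionOfSingularities-17941
`CyclicQuotientFourfolds`, line `s1a-logminvertex` v13 (`stub_reachLowerInFX`).

ABSTRACT SETTING (lead-1's coordinates; the model ring of the `[Y]₂` chart of move 3): a commutative ring `Q` with elements `t`, `s` (exceptional parameters of
moves 2, 1), `Y′` (= `YT₃²`, unit), `X₁`, `Z` (units), `x₃`, `W′` (= `wT₃`), `s₃` (exceptional parameter of move 3) and an automorphism `τ` with rows
`τ t = t`, `τ s = s`, `τ Y′ = Y′`, `τ Z = Z`, `τ s₃ = s₃`, `τ X₁ = X₁ + s·t·Y′·s₃²`, `τ W′ = W′ + s²·t·Y′·s₃`, `τ x₃ = x₃ − s·t·X₁·Z·W′·s₃`, all further generators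
`τ`-fixed. Centre `(s₃, W′, s)` with weights `(1, 1, 2)` — lead-1 takes the `τ`-FIXED `s = e₁` as the weight-2 generator instead of X-CERT's `e₂` (same Rees
algebra: `s ≡ t·Z/X₁` modulo `W′s₃`), which makes all three kills ONE-ROW. `β = s·t·s₃`, shift 1. On `R^w(Q) = Q[s₄, A = s₃T, B = W′T, C = sT²]`:
* `d4m4_admissible`, `d4m4_map_le`; ★ `d4m4_augmentationIdeal_sigmaR_le` — (H1): `aug σ_R ≤ (s t s₃ · s₄)`;
* `d4m4_sigmaR_X₁_sub` (`= (β s₄)·(Y′A)`), `d4m4_sigmaR_u'_one_sub` (`σ_R B − B = (β s₄)·(C Y′)`), `d4m4_sigmaR_x₃_sub` (`= (β s₄)·(−X₁ Z B)`);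
* ★★ `d4m4_residual_mem` — `Y′·A, X₁·Z·B, C·Y′ ∈ 𝔞₄ = (aug σ_R : β s₄)`: the `[s₃]` chart (`A` unit), the norm chart `N(W′)` (`B` unit) and the `[s]₂` chart
  (`C` unit) are ALL KILLED (`Y′`, `X₁`, `Z` being units of `Q`).
-/

set_option linter.dupNamespace false

noncomputable section

open Literature.AlgebraicGeometry.Resolution
open scoped LaurentPolynomial
open Summit.ResolutionOfSingularities.ResolutionOfSingularities.Theorems.WildQuotientResolution.S1.CoarseChart
open Summit.ResolutionOfSingularities.ResolutionOfSingularities.Theorems.WildQuotientResolution.S1.BlowupCharts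

namespace Summit.ResolutionOfSingularities.ResolutionOfSingularities.Theorems.WildQuotientResolution.S1.KillCert.D4

variable {Q : Type} [CommRing Q] (τ : Q ≃+* Q) (t s Y' X₁ Z x₃ W' s₃ : Q) (Gfix : Set Q)
  (ht : τ t = t) (hs : τ s = s) (hY' : τ Y' = Y') (hZ : τ Z = Z) (hs₃ : τ s₃ = s₃) (hX₁ : τ X₁ = X₁ + s * t * Y' * s₃ ^ 2)
  (hW' : τ W' = W' + s ^ 2 * t * Y' * s₃) (hx₃ : τ x₃ = x₃ - s * t * X₁ * Z * W' * s₃)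
  (hfix : ∀ g ∈ Gfix, τ g = g) (hgen : Subring.closure (({t, s, Y', X₁, Z, x₃, W', s₃} : Set Q) ∪ Gfix) = ⊤)

/-! ## (a′)₁ relative to `β = s·t·s₃` -/

include ht hs hY' hZ hs₃ hX₁ hW' hx₃ hfix hgen in
/-- **(a′)₁ for move 4 of MT-D₄**: `y ∈ 𝒥ₙ((s₃, W′, s), (1,1,2)) ⇒ τ y − y ∈ (s t s₃)·𝒥ₙ₊₁`. [OURS · L1 W4.5c · R-F15e move 4] -/
theorem d4m4_admissible : ∀ (n : ℕ) (y : Q), y ∈ (weightedFiltration (![s₃, W', s] : Fin 3 → Q) ![1, 1, 2]).ideal n →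
    τ y - y ∈ Ideal.span {s * t * s₃} * (weightedFiltration (![s₃, W', s] : Fin 3 → Q) ![1, 1, 2]).ideal (n + 1) := by
  intro n y hy
  have hJ0 : s₃ ∈ (weightedFiltration (![s₃, W', s] : Fin 3 → Q) ![1, 1, 2]).ideal 1 := mem_weightedFiltration_ideal (![s₃, W', s] : Fin 3 → Q) ![1, 1, 2] 0
  have hJ1 : W' ∈ (weightedFiltration (![s₃, W', s] : Fin 3 → Q) ![1, 1, 2]).ideal 1 := mem_weightedFiltration_ideal (![s₃, W', s] : Fin 3 → Q) ![1, 1, 2] 1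
  have hJ2 : s ∈ (weightedFiltration (![s₃, W', s] : Fin 3 → Q) ![1, 1, 2]).ideal 2 := mem_weightedFiltration_ideal (![s₃, W', s] : Fin 3 → Q) ![1, 1, 2] 2
  have hβJ : ∀ {m : ℕ} {y : Q}, y ∈ (weightedFiltration (![s₃, W', s] : Fin 3 → Q) ![1, 1, 2]).ideal m →
      s * t * s₃ * y ∈ Ideal.span {s * t * s₃} * (weightedFiltration (![s₃, W', s] : Fin 3 → Q) ![1, 1, 2]).ideal m :=
    fun hy => Ideal.mul_mem_mul (Ideal.mem_span_singleton_self (s * t * s₃)) hy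
  have hzero : ∀ {m : ℕ} {y : Q}, τ y = y → τ y - y ∈ Ideal.span {s * t * s₃} * (weightedFiltration (![s₃, W', s] : Fin 3 → Q) ![1, 1, 2]).ideal m :=
    fun h => by rw [h, sub_self]; exact Ideal.zero_mem _
  have m_X₁ : τ X₁ - X₁ ∈ Ideal.span {s * t * s₃} * (weightedFiltration (![s₃, W', s] : Fin 3 → Q) ![1, 1, 2]).ideal 1 := by
    rw [hX₁, show X₁ + s * t * Y' * s₃ ^ 2 - X₁ = s * t * s₃ * (Y' * s₃) by ring]
    exact hβJ (Ideal.mul_mem_left _ _ hJ0)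
  have m_W' : τ W' - W' ∈ Ideal.span {s * t * s₃} * (weightedFiltration (![s₃, W', s] : Fin 3 → Q) ![1, 1, 2]).ideal (1 + 1) := by
    rw [hW', show W' + s ^ 2 * t * Y' * s₃ - W' = s * t * s₃ * (Y' * s) by ring]
    exact hβJ (Ideal.mul_mem_left _ _ hJ2)
  have m_x₃ : τ x₃ - x₃ ∈ Ideal.span {s * t * s₃} * (weightedFiltration (![s₃, W', s] : Fin 3 → Q) ![1, 1, 2]).ideal 1 := by
    rw [hx₃, show x₃ - s * t * X₁ * Z * W' * s₃ - x₃ = s * t * s₃ * (-(X₁ * Z) * W') by ring]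
    exact hβJ (Ideal.mul_mem_left _ _ hJ1)
  refine admissible_of_generators (![s₃, W', s] : Fin 3 → Q) ![1, 1, 2] τ (s * t * s₃) _ hgen ?_ ?_ n y hy
  · rintro g (hg | hg)
    · simp only [Set.mem_insert_iff, Set.mem_singleton_iff] at hg
      rcases hg with rfl | rfl | rfl | rfl | rfl | rfl | rfl | rfl
      · exact hzero ht
      · exact hzero hs
      · exact hzero hY'
      · exact m_X₁
      · exact hzero hZ
      · exact m_x₃
      · exact (Ideal.mul_mono_right ((weightedFiltration _ _).antitone (by norm_num : 1 ≤ 1 + 1))) m_W'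
      · exact hzero hs₃
    · exact hzero (hfix g hg)
  · intro i
    fin_cases i
    · exact hzero hs₃
    · exact m_W'
    · exact hzero hs

include ht hs hY' hZ hs₃ hX₁ hW' hx₃ hfix hgen in
/-- **`τ`-stability** of the move-4 filtration. -/
theorem d4m4_map_le : ∀ n : ℕ,
    ((weightedFiltration (![s₃, W', s] : Fin 3 → Q) ![1, 1, 2]).ideal n).map (τ : Q →+* Q) ≤ (weightedFiltration (![s₃, W', s] : Fin 3 → Q) ![1, 1, 2]).ideal n :=
  fun n => map_le_of_admissible (![s₃, W', s] : Fin 3 → Q) ![1, 1, 2] τ (s * t * s₃)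
    (d4m4_admissible τ t s Y' X₁ Z x₃ W' s₃ Gfix ht hs hY' hZ hs₃ hX₁ hW' hx₃ hfix hgen) n

/-! ## (H1) and the residual ideal: three one-row kills -/

section Residual

variable {p : ℕ} (hp : 0 < p) (hσp : ∀ x : Q, (⇑τ)^[p] x = x)

include ht hs hY' hZ hs₃ hX₁ hW' hx₃ hfix hgen in
/-- ★ **(H1) for move 4**: on `R₄ = Q[s₄, s₃T, W′T, sT²]`, `aug σ_R ≤ ((s t s₃)·s₄)`. -/
theorem d4m4_augmentationIdeal_sigmaR_le :
    augmentationIdeal (sigmaR τ (![s₃, W', s] : Fin 3 → Q) ![1, 1, 2]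
        (d4m4_map_le τ t s Y' X₁ Z x₃ W' s₃ Gfix ht hs hY' hZ hs₃ hX₁ hW' hx₃ hfix hgen) hp hσp) ≤
      Ideal.span {algebraMap Q _ (s * t * s₃) * cobordantAlgebra.s (![s₃, W', s] : Fin 3 → Q) ![1, 1, 2]} :=
  augmentationIdeal_sigmaR_le_span_of_admissible (![s₃, W', s] : Fin 3 → Q) ![1, 1, 2] τ _ hp hσp (s * t * s₃)
    (d4m4_admissible τ t s Y' X₁ Z x₃ W' s₃ Gfix ht hs hY' hZ hs₃ hX₁ hW' hx₃ hfix hgen)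

include hX₁ in
/-- Row of `X₁`: `σ_R X₁ − X₁ = s t Y′ s₃² = ((s t s₃)·s₄)·(Y′·A)` (`A = s₃T`). -/
theorem d4m4_sigmaR_X₁_sub
    (hσJ : ∀ n : ℕ, ((weightedFiltration (![s₃, W', s] : Fin 3 → Q) ![1, 1, 2]).ideal n).map (τ : Q →+* Q) ≤
      (weightedFiltration (![s₃, W', s] : Fin 3 → Q) ![1, 1, 2]).ideal n) :
    sigmaR τ (![s₃, W', s] : Fin 3 → Q) ![1, 1, 2] hσJ hp hσp (algebraMap Q _ X₁) - algebraMap Q _ X₁ =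
      (algebraMap Q _ (s * t * s₃) * cobordantAlgebra.s (![s₃, W', s] : Fin 3 → Q) ![1, 1, 2]) *
        (algebraMap Q _ Y' * cobordantAlgebra.u' (![s₃, W', s] : Fin 3 → Q) ![1, 1, 2] 0) := by
  refine Subtype.ext ?_
  rw [AddSubgroupClass.coe_sub, MulMemClass.coe_mul, MulMemClass.coe_mul, MulMemClass.coe_mul, sigmaR_algebraMap, cobordantAlgebra.coe_algebraMap,
    cobordantAlgebra.coe_algebraMap, cobordantAlgebra.coe_algebraMap, cobordantAlgebra.coe_algebraMap, cobordantAlgebra.coe_s, cobordantAlgebra.coe_u']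
  change LaurentPolynomial.C (τ X₁) - LaurentPolynomial.C X₁ =
    LaurentPolynomial.C (s * t * s₃) * LaurentPolynomial.T (-1) * (LaurentPolynomial.C Y' * (LaurentPolynomial.C s₃ * LaurentPolynomial.T ((1 : ℕ) : ℤ)))
  rw [hX₁]
  simp only [map_add, map_mul, map_pow]
  have hT : LaurentPolynomial.T (-1) * LaurentPolynomial.T ((1 : ℕ) : ℤ) = (1 : Q[T;T⁻¹]) := by
    rw [← LaurentPolynomial.T_add]; norm_num
  calc _ = LaurentPolynomial.C s * LaurentPolynomial.C t * LaurentPolynomial.C Y' * LaurentPolynomial.C s₃ ^ 2 *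
        (LaurentPolynomial.T (-1) * LaurentPolynomial.T ((1 : ℕ) : ℤ)) := by rw [hT]; ring
    _ = _ := by ring

include hW' in
/-- Row of `B = W′T`: `σ_R B − B = (s² t Y′ s₃)·T = ((s t s₃)·s₄)·(C·Y′)` (`C = sT²`). -/
theorem d4m4_sigmaR_u'_one_sub
    (hσJ : ∀ n : ℕ, ((weightedFiltration (![s₃, W', s] : Fin 3 → Q) ![1, 1, 2]).ideal n).map (τ : Q →+* Q) ≤
      (weightedFiltration (![s₃, W', s] : Fin 3 → Q) ![1, 1, 2]).ideal n) :
    sigmaR τ (![s₃, W', s] : Fin 3 → Q) ![1, 1, 2] hσJ hp hσp (cobordantAlgebra.u' (![s₃, W', s] : Fin 3 → Q) ![1, 1, 2] 1) -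
        cobordantAlgebra.u' (![s₃, W', s] : Fin 3 → Q) ![1, 1, 2] 1 =
      (algebraMap Q _ (s * t * s₃) * cobordantAlgebra.s (![s₃, W', s] : Fin 3 → Q) ![1, 1, 2]) *
        (cobordantAlgebra.u' (![s₃, W', s] : Fin 3 → Q) ![1, 1, 2] 2 * algebraMap Q _ Y') := by
  refine Subtype.ext ?_
  have hu1 : cobordantAlgebra.u' (![s₃, W', s] : Fin 3 → Q) ![1, 1, 2] 1 =
      ⟨LaurentPolynomial.C W' * LaurentPolynomial.T (((![1, 1, 2] : Fin 3 → ℕ) 1 : ℕ) : ℤ), (cobordantAlgebra.u' (![s₃, W', s] : Fin 3 → Q) ![1, 1, 2] 1).2⟩ := rfl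
  rw [AddSubgroupClass.coe_sub, MulMemClass.coe_mul, MulMemClass.coe_mul, MulMemClass.coe_mul, cobordantAlgebra.coe_algebraMap, cobordantAlgebra.coe_s,
    cobordantAlgebra.coe_u', hu1, sigmaR_mk, cobordantAlgebra.coe_u', cobordantAlgebra.coe_algebraMap]
  change LaurentPolynomial.C (τ W') * LaurentPolynomial.T ((1 : ℕ) : ℤ) - LaurentPolynomial.C W' * LaurentPolynomial.T ((1 : ℕ) : ℤ) =
    LaurentPolynomial.C (s * t * s₃) * LaurentPolynomial.T (-1) * (LaurentPolynomial.C s * LaurentPolynomial.T ((2 : ℕ) : ℤ) * LaurentPolynomial.C Y')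
  rw [hW']
  simp only [map_add, map_mul, map_pow]
  have hT : LaurentPolynomial.T (-1) * LaurentPolynomial.T ((2 : ℕ) : ℤ) = (LaurentPolynomial.T ((1 : ℕ) : ℤ) : Q[T;T⁻¹]) := by
    rw [← LaurentPolynomial.T_add]; norm_num
  calc _ = LaurentPolynomial.C s ^ 2 * LaurentPolynomial.C t * LaurentPolynomial.C Y' * LaurentPolynomial.C s₃ *
        (LaurentPolynomial.T (-1) * LaurentPolynomial.T ((2 : ℕ) : ℤ)) := by rw [hT]; ring
    _ = _ := by ring

include hx₃ in
/-- Row of `x₃`: `σ_R x₃ − x₃ = −s t X₁ Z W′ s₃ = ((s t s₃)·s₄)·(−X₁·Z·B)` (`B = W′T`). -/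
theorem d4m4_sigmaR_x₃_sub
    (hσJ : ∀ n : ℕ, ((weightedFiltration (![s₃, W', s] : Fin 3 → Q) ![1, 1, 2]).ideal n).map (τ : Q →+* Q) ≤
      (weightedFiltration (![s₃, W', s] : Fin 3 → Q) ![1, 1, 2]).ideal n) :
    sigmaR τ (![s₃, W', s] : Fin 3 → Q) ![1, 1, 2] hσJ hp hσp (algebraMap Q _ x₃) - algebraMap Q _ x₃ =
      (algebraMap Q _ (s * t * s₃) * cobordantAlgebra.s (![s₃, W', s] : Fin 3 → Q) ![1, 1, 2]) *
        -(algebraMap Q _ X₁ * algebraMap Q _ Z * cobordantAlgebra.u' (![s₃, W', s] : Fin 3 → Q) ![1, 1, 2] 1) := by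
  refine Subtype.ext ?_
  rw [AddSubgroupClass.coe_sub, MulMemClass.coe_mul, NegMemClass.coe_neg, MulMemClass.coe_mul, MulMemClass.coe_mul, MulMemClass.coe_mul, sigmaR_algebraMap,
    cobordantAlgebra.coe_algebraMap, cobordantAlgebra.coe_algebraMap, cobordantAlgebra.coe_algebraMap, cobordantAlgebra.coe_algebraMap, cobordantAlgebra.coe_algebraMap,
    cobordantAlgebra.coe_s, cobordantAlgebra.coe_u']
  change LaurentPolynomial.C (τ x₃) - LaurentPolynomial.C x₃ =
    LaurentPolynomial.C (s * t * s₃) * LaurentPolynomial.T (-1) *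
      -(LaurentPolynomial.C X₁ * LaurentPolynomial.C Z * (LaurentPolynomial.C W' * LaurentPolynomial.T ((1 : ℕ) : ℤ)))
  rw [hx₃]
  simp only [map_sub, map_mul]
  have hT : LaurentPolynomial.T (-1) * LaurentPolynomial.T ((1 : ℕ) : ℤ) = (1 : Q[T;T⁻¹]) := by
    rw [← LaurentPolynomial.T_add]; norm_num
  calc _ = -(LaurentPolynomial.C s * LaurentPolynomial.C t * LaurentPolynomial.C X₁ * LaurentPolynomial.C Z * LaurentPolynomial.C W' * LaurentPolynomial.C s₃ *
        (LaurentPolynomial.T (-1) * LaurentPolynomial.T ((1 : ℕ) : ℤ))) := by rw [hT]; ring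
    _ = _ := by ring

include ht hs hY' hZ hs₃ hX₁ hW' hx₃ hfix hgen in
/-- ★★ **THE THREE KILL ROWS OF MOVE 4**: `Y′·A ∈ 𝔞₄` (row of `X₁`; kills the `[s₃]` chart), `X₁·Z·B ∈ 𝔞₄` (row of `x₃`; kills the norm chart `N(W′)`),
`C·Y′ ∈ 𝔞₄` (row of `B`; kills the `[s]₂` chart), `𝔞₄ = (aug σ_R : (s t s₃)·s₄)`. [OURS · L1 W4.5c · X-CERT v1.2-D4ROWS move 4, lead-1's centre `(s₃, W′, s)`] -/
theorem d4m4_residual_mem :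
    algebraMap Q _ Y' * cobordantAlgebra.u' (![s₃, W', s] : Fin 3 → Q) ![1, 1, 2] 0 ∈
        (augmentationIdeal (sigmaR τ (![s₃, W', s] : Fin 3 → Q) ![1, 1, 2]
          (d4m4_map_le τ t s Y' X₁ Z x₃ W' s₃ Gfix ht hs hY' hZ hs₃ hX₁ hW' hx₃ hfix hgen) hp hσp)).colon
          (Ideal.span {algebraMap Q _ (s * t * s₃) * cobordantAlgebra.s (![s₃, W', s] : Fin 3 → Q) ![1, 1, 2]}) ∧
      algebraMap Q _ X₁ * algebraMap Q _ Z * cobordantAlgebra.u' (![s₃, W', s] : Fin 3 → Q) ![1, 1, 2] 1 ∈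
        (augmentationIdeal (sigmaR τ (![s₃, W', s] : Fin 3 → Q) ![1, 1, 2]
          (d4m4_map_le τ t s Y' X₁ Z x₃ W' s₃ Gfix ht hs hY' hZ hs₃ hX₁ hW' hx₃ hfix hgen) hp hσp)).colon
          (Ideal.span {algebraMap Q _ (s * t * s₃) * cobordantAlgebra.s (![s₃, W', s] : Fin 3 → Q) ![1, 1, 2]}) ∧
      cobordantAlgebra.u' (![s₃, W', s] : Fin 3 → Q) ![1, 1, 2] 2 * algebraMap Q _ Y' ∈
        (augmentationIdeal (sigmaR τ (![s₃, W', s] : Fin 3 → Q) ![1, 1, 2]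
          (d4m4_map_le τ t s Y' X₁ Z x₃ W' s₃ Gfix ht hs hY' hZ hs₃ hX₁ hW' hx₃ hfix hgen) hp hσp)).colon
          (Ideal.span {algebraMap Q _ (s * t * s₃) * cobordantAlgebra.s (![s₃, W', s] : Fin 3 → Q) ![1, 1, 2]}) := by
  refine ⟨?_, ?_, ?_⟩
  · rw [Ideal.mem_colon_span_singleton, mul_comm, ← d4m4_sigmaR_X₁_sub τ t s Y' X₁ W' s₃ hX₁ hp hσp]
    exact sub_mem_augmentationIdeal _ _
  · rw [Ideal.mem_colon_span_singleton]
    have h := neg_mem (sub_mem_augmentationIdeal (sigmaR τ (![s₃, W', s] : Fin 3 → Q) ![1, 1, 2]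
      (d4m4_map_le τ t s Y' X₁ Z x₃ W' s₃ Gfix ht hs hY' hZ hs₃ hX₁ hW' hx₃ hfix hgen) hp hσp) (algebraMap Q _ x₃))
    rw [d4m4_sigmaR_x₃_sub τ t s X₁ Z x₃ W' s₃ hx₃ hp hσp] at h
    convert h using 1
    ring
  · rw [Ideal.mem_colon_span_singleton, mul_comm, ← d4m4_sigmaR_u'_one_sub τ t s Y' W' s₃ hW' hp hσp]
    exact sub_mem_augmentationIdeal _ _

end Residual

end Summit.ResolutionOfSingularities.ResolutionOfSingularities.Theorems.WildQuotientResolution.S1.KillCert.D4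

end
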